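import Mathlib
import HarnessLib
import Summits.HubbardSuperconductivity.HubbardSuperconductivity.Theorems.KLProgrammeKLRegimeSectorSlicePair

/-!
# Route `KLProgramme` — engine support (route (L2)): the propagator constant `α_n` of the sectorised single-scale step — the row and column sums
# of `Sᵀ(F)·C^K_{(Λ,Λ′]}·S(F)` from a UNIFORM per-pair bound on adjacent sectors and the vanishing of non-adjacent pairs

Cell `gate-hubbard-kl`, seat hubbard-kl-k3c2-p3 (row «sector-counting import (DR2000 L11/L12) for the leg-dress bar»), for the ENGINE child
(gen 4 stmt-HubbardSuperconductivity-19855 `KLRegimeEngineV12`, `stub_engine_step_norms`).  The hypotheses `hrow`/`hcol` of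
`SectorisedEffectiveActionBound.hubbardSectorKernelNorm_effAction_le_of_sectorNorm` for the zero-seed counterterm slice covariance
`C = hubbardCovSliceCT L M β μ 0 K Λ Λ′` pulled back by `S = sectorSubMatrix L M β F`:

* **`rowSum_norm_pullback_sliceCT_le_alpha`** / **`colSum_norm_pullback_sliceCT_le_alpha`** — if the per-pair character-sum `ℓ¹` norm
  `T(ω,ω′) = Σ_z ‖Σ_q χ_{q₁}(z₁)χ_{q₂}(z₂) • (βL²)⁻²F_ω F_{ω′} Ψ̂(q)‖` is `≤ T_max` for adjacent pairs, the multiplier supports of non-adjacent pairs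
  are disjoint, and every sector has at most `novl` adjacent ones (in both slots), then
  `Σ_{Y′} ‖(Sᵀ C S) Y Y′‖ ≤ 8·novl·T_max` and `Σ_{Y} ‖(Sᵀ C S) Y Y′‖ ≤ 8·novl·T_max` — i.e. `α_n := 8·novl·T_max`, with `T_max` supplied by
  `KLProgrammeKLRegimeSectorSlicePair.slicePair_charSum_l1_le` from multiplier data.

Everything is proved; no definitions, no named facts. [folklore]

References: G. Benfatto, A. Giuliani, V. Mastropietro, Ann. Henri Poincaré 7 (2006) 809–898, §2.8 (2.81); M. Disertori, V. Rivasseau,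
Comm. Math. Phys. 215 (2000) 251–290, §IV.2 Lemma 4.
-/

noncomputable section

namespace Summit.HubbardSuperconductivity.HubbardSuperconductivity.Theorems.TorusFourierL2

set_option linter.dupNamespace false -- summit = problem name (single-conjunct summit), D-0017

open Finset Complex Literature.MathematicalPhysics.QuantumLattice Literature.Probability.LatticeModels
open scoped Real

section Alpha

variable {L M N : ℕ} [NeZero L] [NeZero M]

/-- **Row sums: `α = 8·novl·T_max`.**  For the zero-seed CT slice covariance pulled back by `S = sectorSubMatrix L M β F`: if for adjacent
pairs the per-pair character-sum `ℓ¹` norm is `≤ T_max`, for non-adjacent pairs `F_ω F_{ω′} ≡ 0`, and every sector has `≤ novl` adjacent partners,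
then `Σ_{Y′} ‖(Sᵀ C S) Y Y′‖ ≤ 8·novl·T_max`. [cite: BenfattoGiulianiMastropietro2006, §2.8 (2.81)] -/
theorem rowSum_norm_pullback_sliceCT_le_alpha {β : ℝ} (hβ : β ≠ 0) (μ : ℝ) (K : TrigPolyC4v) (Λ Λ' : ℝ)
    (F : Fin N → FreqMomentum L M → ℂ) (Adj : Fin N → Fin N → Prop) [DecidableRel Adj] {Tmax : ℝ} (hTmax : 0 ≤ Tmax)
    (hT : ∀ ω ω', Adj ω ω' → ∑ z : TorusSite 1 (2 * M) × TorusSite 2 L,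
        ‖∑ q : TorusSite 1 (2 * M) × TorusSite 2 L, (torusChar q.1 z.1 * torusChar q.2 z.2) •
          ((((1 / (β * (L : ℝ) ^ 2) : ℝ) : ℂ) ^ 2 *
            (F ω (⟨(q.1 0).val, ZMod.val_lt (q.1 0)⟩, q.2) * F ω' (⟨(q.1 0).val, ZMod.val_lt (q.1 0)⟩, q.2) *
              sliceSymbolFnXi (β * (L : ℝ) ^ 2) 0 Λ Λ' (matsubaraFreq β M ⟨(q.1 0).val, ZMod.val_lt (q.1 0)⟩)
                (nambuXiCT L μ K q.2))))‖ ≤ Tmax)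
    (hdisj : ∀ ω ω', ¬ Adj ω ω' → ∀ k : FreqMomentum L M, F ω k * F ω' k = 0)
    {novl : ℕ} (hcard : ∀ ω, (univ.filter fun ω' => Adj ω ω').card ≤ novl) (Y : SpaceTimeIdx L M × SectorLeg N) :
    ∑ Y' : SpaceTimeIdx L M × SectorLeg N,
        ‖((sectorSubMatrix L M β F).transpose * hubbardCovSliceCT L M β μ 0 K Λ Λ' * sectorSubMatrix L M β F) Y Y'‖ ≤
      8 * (novl * Tmax) := by
  classical
  refine (rowSum_norm_pullback_sliceCT_le hβ μ K Λ Λ' F Y).trans (mul_le_mul_of_nonneg_left ?_ (by norm_num))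
  -- the per-pair quantity as a function of the pair
  set T : Fin N → Fin N → ℝ := fun ω ω' => ∑ z : TorusSite 1 (2 * M) × TorusSite 2 L,
    ‖∑ q : TorusSite 1 (2 * M) × TorusSite 2 L, (torusChar q.1 z.1 * torusChar q.2 z.2) •
      ((((1 / (β * (L : ℝ) ^ 2) : ℝ) : ℂ) ^ 2 *
        (F ω (⟨(q.1 0).val, ZMod.val_lt (q.1 0)⟩, q.2) * F ω' (⟨(q.1 0).val, ZMod.val_lt (q.1 0)⟩, q.2) *
          sliceSymbolFnXi (β * (L : ℝ) ^ 2) 0 Λ Λ' (matsubaraFreq β M ⟨(q.1 0).val, ZMod.val_lt (q.1 0)⟩)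
            (nambuXiCT L μ K q.2))))‖ with hTdef
  have hTle : ∀ ω ω', T ω ω' ≤ Tmax := by
    intro ω ω'
    by_cases h : Adj ω ω'
    · exact hT ω ω' h
    · have hz : T ω ω' = 0 := by
        rw [hTdef]
        dsimp only
        have h0 := sliceCharSum_l1_eq_zero_of_mul_eq_zero ((((1 / (β * (L : ℝ) ^ 2) : ℝ) : ℂ)) ^ 2)
          (fun q : TorusSite 1 (2 * M) × TorusSite 2 L =>
            F ω (⟨(q.1 0).val, ZMod.val_lt (q.1 0)⟩, q.2) * F ω' (⟨(q.1 0).val, ZMod.val_lt (q.1 0)⟩, q.2))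
          (fun q : TorusSite 1 (2 * M) × TorusSite 2 L =>
            sliceSymbolFnXi (β * (L : ℝ) ^ 2) 0 Λ Λ' (matsubaraFreq β M ⟨(q.1 0).val, ZMod.val_lt (q.1 0)⟩) (nambuXiCT L μ K q.2))
          (fun q => hdisj ω ω' h _)
        simp only [mul_assoc] at h0 ⊢
        exact h0
      rw [hz]; exact hTmax
  have hzero : ∀ ω ω', ¬ Adj ω ω' → T ω ω' = 0 := by
    intro ω ω' h
    rw [hTdef]
    dsimp only
    have h0 := sliceCharSum_l1_eq_zero_of_mul_eq_zero ((((1 / (β * (L : ℝ) ^ 2) : ℝ) : ℂ)) ^ 2)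
      (fun q : TorusSite 1 (2 * M) × TorusSite 2 L =>
        F ω (⟨(q.1 0).val, ZMod.val_lt (q.1 0)⟩, q.2) * F ω' (⟨(q.1 0).val, ZMod.val_lt (q.1 0)⟩, q.2))
      (fun q : TorusSite 1 (2 * M) × TorusSite 2 L =>
        sliceSymbolFnXi (β * (L : ℝ) ^ 2) 0 Λ Λ' (matsubaraFreq β M ⟨(q.1 0).val, ZMod.val_lt (q.1 0)⟩) (nambuXiCT L μ K q.2))
      (fun q => hdisj ω ω' h _)
    simp only [mul_assoc] at h0 ⊢
    exact h0
  exact sum_pair_le_of_overlap T Adj hTmax hTle hzero hcard Y.2.1.1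

/-- **Column sums: `α = 8·novl·T_max`** (adjacency counted in the first slot). [cite: BenfattoGiulianiMastropietro2006, §2.8 (2.81)] -/
theorem colSum_norm_pullback_sliceCT_le_alpha {β : ℝ} (hβ : β ≠ 0) (μ : ℝ) (K : TrigPolyC4v) (Λ Λ' : ℝ)
    (F : Fin N → FreqMomentum L M → ℂ) (Adj : Fin N → Fin N → Prop) [DecidableRel Adj] {Tmax : ℝ} (hTmax : 0 ≤ Tmax)
    (hT : ∀ ω ω', Adj ω ω' → ∑ z : TorusSite 1 (2 * M) × TorusSite 2 L,
        ‖∑ q : TorusSite 1 (2 * M) × TorusSite 2 L, (torusChar q.1 z.1 * torusChar q.2 z.2) •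
          ((((1 / (β * (L : ℝ) ^ 2) : ℝ) : ℂ) ^ 2 *
            (F ω (⟨(q.1 0).val, ZMod.val_lt (q.1 0)⟩, q.2) * F ω' (⟨(q.1 0).val, ZMod.val_lt (q.1 0)⟩, q.2) *
              sliceSymbolFnXi (β * (L : ℝ) ^ 2) 0 Λ Λ' (matsubaraFreq β M ⟨(q.1 0).val, ZMod.val_lt (q.1 0)⟩)
                (nambuXiCT L μ K q.2))))‖ ≤ Tmax)
    (hdisj : ∀ ω ω', ¬ Adj ω ω' → ∀ k : FreqMomentum L M, F ω k * F ω' k = 0)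
    {novl : ℕ} (hcard : ∀ ω', (univ.filter fun ω => Adj ω ω').card ≤ novl) (Y' : SpaceTimeIdx L M × SectorLeg N) :
    ∑ Y : SpaceTimeIdx L M × SectorLeg N,
        ‖((sectorSubMatrix L M β F).transpose * hubbardCovSliceCT L M β μ 0 K Λ Λ' * sectorSubMatrix L M β F) Y Y'‖ ≤
      8 * (novl * Tmax) := by
  classical
  refine (colSum_norm_pullback_sliceCT_le hβ μ K Λ Λ' F Y').trans (mul_le_mul_of_nonneg_left ?_ (by norm_num))
  set T : Fin N → Fin N → ℝ := fun ω ω' => ∑ z : TorusSite 1 (2 * M) × TorusSite 2 L,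
    ‖∑ q : TorusSite 1 (2 * M) × TorusSite 2 L, (torusChar q.1 z.1 * torusChar q.2 z.2) •
      ((((1 / (β * (L : ℝ) ^ 2) : ℝ) : ℂ) ^ 2 *
        (F ω (⟨(q.1 0).val, ZMod.val_lt (q.1 0)⟩, q.2) * F ω' (⟨(q.1 0).val, ZMod.val_lt (q.1 0)⟩, q.2) *
          sliceSymbolFnXi (β * (L : ℝ) ^ 2) 0 Λ Λ' (matsubaraFreq β M ⟨(q.1 0).val, ZMod.val_lt (q.1 0)⟩)
            (nambuXiCT L μ K q.2))))‖ with hTdef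
  have hzero : ∀ ω ω', ¬ Adj ω ω' → T ω ω' = 0 := by
    intro ω ω' h
    rw [hTdef]
    dsimp only
    have h0 := sliceCharSum_l1_eq_zero_of_mul_eq_zero ((((1 / (β * (L : ℝ) ^ 2) : ℝ) : ℂ)) ^ 2)
      (fun q : TorusSite 1 (2 * M) × TorusSite 2 L =>
        F ω (⟨(q.1 0).val, ZMod.val_lt (q.1 0)⟩, q.2) * F ω' (⟨(q.1 0).val, ZMod.val_lt (q.1 0)⟩, q.2))
      (fun q : TorusSite 1 (2 * M) × TorusSite 2 L =>
        sliceSymbolFnXi (β * (L : ℝ) ^ 2) 0 Λ Λ' (matsubaraFreq β M ⟨(q.1 0).val, ZMod.val_lt (q.1 0)⟩) (nambuXiCT L μ K q.2))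
      (fun q => hdisj ω ω' h _)
    simp only [mul_assoc] at h0 ⊢
    exact h0
  have hTle : ∀ ω ω', T ω ω' ≤ Tmax := by
    intro ω ω'
    by_cases h : Adj ω ω'
    · exact hT ω ω' h
    · rw [hzero ω ω' h]; exact hTmax
  exact sum_pair_le_of_overlap' T Adj hTmax hTle hzero hcard Y'.2.1.1

end Alpha

end Summit.HubbardSuperconductivity.HubbardSuperconductivity.Theorems.TorusFourierL2

end
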